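import Mathlib
import HarnessLib
import Summits.HubbardSuperconductivity.HubbardSuperconductivity.Theorems.KLProgrammeKLRegimeEngineTowerLevStepLinkUnitsF

/-!
# Route `KLProgramme` — crux K3 ENGINE (stmt-HubbardSuperconductivity-20437 `KLRegimeEngineV17F2`), stub (b) v2, THE LEVELS PACKAGE (ℓ), located-risk #10
# residual «(ℓ)-LINK-UNIFORM-F» (pen (R301)), PART 2: THE k-UNIFORM FLOOR LINK — the `hstep` binder of the floor-keyed levelled law
# `klTowerBLevF_le_law_lev_of_doors_of_wgridStep` (…TowerLevBaseFWgrid, k3c3-p2) from four k-free bounds on the block data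
# (cell gate-hubbard-kl, seat hubbard-kl-k3c2-p3 g14; the floor twin of …TowerLevStepLink (p4 g18) ∘ …TowerLevStepLinkUniform (g13) on the ORIENTED door;
#  E1 / the LINK-F lane may rename or supersede)

Chain (block `k ≥ 1`, track `t`, `F = t + 1`, degree `2p`):  k3c3-p2's per-level born bound `klTowerBornLev_le_kit_orientedF9` (oriented kit form on #16's
pin-credited instance, graded floor array `Bm`) with the tail majorant `Nt := Bm` (admissible: …LinkUnitsF §3) and the first-order majorant
`NF := 27^F·θ^{lumps F}·Bm` (`θ = (1/2)^{dk−1}`) → the re-truncation `orientedBracket_retruncate_le_kitStep` (door at `N₀ = N + 2(dk−1) + 1`, guard at `2Φ`: the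
tail earns `θ^{lumps F}`) → the literal bracket `kitBrackets_explicitFO_le_literal` → the units identity `kitStep_abs_eq_units_mul` on `Bm = (ε·Kc)·(u^m·μd m)`
(`u = 8^{dk}ε²`, `Kc = 2^{−5dk}ε^{−2}`, `μd m = (32ε/27)·8^{−m}·klTowerMuLevF … m`) → division by `klLevUnitF β M t p (dk) = 2^{−klLevGain t·dk}·(ε·Kc)·u^p`, where
`θ^{lumps F}·2^{klLevGain t·dk} = 2^{klLevGain t}` (`klLevGain t = lumps F`) and `27^F·2^{klLevGain t} ≤ 4·27^5` → the output constant `(ε·e²·c̄c)^{2p−1}` and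
`4·27^5·e⁴/2·c̄r` moved into the array (second units identity).  At the k-free bounds `κ_k²·8^{dk} ≤ κ̄²`, `α_k ≤ ᾱ·4^{dk}`, overlap rows/cols `≤ c̄r, c̄c` the
parameters are k-INDEPENDENT:

  **`σ̄ = κ̄²/(e⁴c̄c²)`, `τ̄ = e²κ̄²/c̄c²`, `ψ̄ = e⁴c̄c²/κ̄²`** (as in g13), **`Φ̄ = 9ᾱc̄c/(27⁵·e·κ̄²·c̄r)`, `W̄ = 64·27⁴·e²·c̄r/c̄c`, `Z̄ = e⁴c̄c²ε²/8`**.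

* §1 **`klTowerBLevF_succ_le_kitStep_of_bounds`** — blocks `k ≥ 1` (`2 ≤ dk`): `klTowerBLevF … d t (k+1) p ≤ towerFO D σ̄ μ p + Σ_{n∈[2,N]} e·Φ̄^{n−1}·ψ̄^p·towerS D τ̄ μ n p +
  ψ̄^p·e·V·(Φ̄V)^N/(1−Φ̄V)`, `μ m = W̄·Z̄^m·klTowerMuLevF … d k m`, under the guard `Φ̄·towerV D τ̄ μ < 1`;
* §2 **`levLawF_hstep_of_blockBounds`** — the `hstep` binder of `klTowerBLevF_le_law_lev_of_doors_of_wgridStep` VERBATIM (blocks `1 ≤ k < Kb`, `2 ≤ d`), the six names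
  `W Z σ τ ψ Φ` pinned by equational binders (instantiate with `rfl`).
Compositions of landed theorems and real algebra; nothing about the model is asserted beyond them; nothing asserts (ℓ), any stub, K3 or superconductivity.
References: BGM 2006 §2.8 (2.76)–(2.84), (2.93)–(2.98), §3 (3.2)–(3.8), Lemma 2.5 [cite: BenfattoGiulianiMastropietro2006].
-/

noncomputable section

namespace Summit.HubbardSuperconductivity.HubbardSuperconductivity.Theorems.EngineV8

set_option linter.dupNamespace false -- summit = problem name (single-conjunct summit), D-0017

open Classical
open Real Finset Literature.MathematicalPhysics.QuantumLattice Literature.Probability.LatticeModels GrassmannAlgebra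
open Literature.MathematicalPhysics.QuantumLattice.FermiRG Literature.MathematicalPhysics.QuantumLattice.FermiRG.BGM2006Routing
open Summit.HubbardSuperconductivity.HubbardSuperconductivity.Theorems.KLProgrammeLegKernels
open Summit.HubbardSuperconductivity.HubbardSuperconductivity.Theorems.KLRegimeSplit
open Summit.HubbardSuperconductivity.HubbardSuperconductivity.Theorems.KLRegimeWick
open Summit.HubbardSuperconductivity.HubbardSuperconductivity.Theorems.TwoPointAssembly
open Summit.HubbardSuperconductivity.HubbardSuperconductivity.Theorems.DispersionFlow

variable {L M : ℕ} [NeZero L] [NeZero M]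

/-! ## §1 Blocks `k ≥ 1` at the bounds: k-free parameters -/

set_option maxHeartbeats 400000 in
/-- **THE FLOOR-KEYED LEVELLED BLOCK STEP (`k ≥ 1`, `2 ≤ dk`) AT k-FREE BOUNDS OF THE BLOCK DATA, ON THE ORIENTED DOOR.**  If the block's Gram constant satisfies
`κ²·8^{dk} ≤ κ̄²`, its decay constant `α ≤ ᾱ·4^{dk}`, and its analysis-overlap row/column sums are `≤ c̄r`, `≤ c̄c`, then for every track `t` and degree `2(q+1)`
the floor born array of `Δ_k` obeys the kit's literal step with the k-INDEPENDENT parameters `σ̄ = κ̄²/(e⁴c̄c²)`, `τ̄ = e²κ̄²/c̄c²`, `ψ̄ = e⁴c̄c²/κ̄²`,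
`Φ̄ = 9ᾱc̄c/(27⁵·e·κ̄²·c̄r)` at the scaled floor measured array `W̄·Z̄^m·klTowerMuLevF … d k m`, `W̄ = 64·27⁴·e²·c̄r/c̄c`, `Z̄ = e⁴c̄c²ε²/8`.
[cite: BenfattoGiulianiMastropietro2006, §2.8 (2.76)-(2.84), (2.97)-(2.98), §3 (3.2)-(3.8)] -/
theorem klTowerBLevF_succ_le_kitStep_of_bounds {β : ℝ} (hβ : 0 < β) (U μ : ℝ) (K : TrigPolyC4v) {d k : ℕ} (hd : 1 ≤ d) (hk : 1 ≤ k) (hdk : 2 ≤ d * k)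
    (hZ : hubbardEffPartitionFnCT L M β U μ 0 K (klScale klE0 (d * k)) ≠ 0)
    {κ κb : ℝ} (hκ : 0 < κ) (hκb : 0 < κb) (hκκb : κ ^ 2 * (8 : ℝ) ^ (d * k) ≤ κb ^ 2)
    (hGB : IsGramBoundedR ((sectorSubMatrix L M β (bgmFatMultiplier L M klE0 β (nambuXiCT L μ K) (d * k - 1))).transpose *
      hubbardCovSliceCT L M β μ 0 K (klScale klE0 (d * (k + 1))) (klScale klE0 (d * k)) *
        sectorSubMatrix L M β (bgmFatMultiplier L M klE0 β (nambuXiCT L μ K) (d * k - 1))) κ)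
    {α αb : ℝ} (hαb : 0 < αb) (hααb : α ≤ αb * (4 : ℝ) ^ (d * k))
    (hrow : ∀ X, ∑ Y, ‖((sectorSubMatrix L M β (bgmFatMultiplier L M klE0 β (nambuXiCT L μ K) (d * k - 1))).transpose *
        hubbardCovSliceCT L M β μ 0 K (klScale klE0 (d * (k + 1))) (klScale klE0 (d * k)) *
          sectorSubMatrix L M β (bgmFatMultiplier L M klE0 β (nambuXiCT L μ K) (d * k - 1))) X Y‖ ≤ α)
    (hcol : ∀ Y, ∑ X, ‖((sectorSubMatrix L M β (bgmFatMultiplier L M klE0 β (nambuXiCT L μ K) (d * k - 1))).transpose *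
        hubbardCovSliceCT L M β μ 0 K (klScale klE0 (d * (k + 1))) (klScale klE0 (d * k)) *
          sectorSubMatrix L M β (bgmFatMultiplier L M klE0 β (nambuXiCT L μ K) (d * k - 1))) X Y‖ ≤ α)
    {crb ccb : ℝ} (hcrb : 0 < crb) (hccb : 0 < ccb)
    (hrow' : ∀ X'', ∑ X', ‖(sectorAnalysisMatrix L M β (klAnisoFamily L M β μ K klE0 (d * k)) *
        sectorSubMatrix L M β (bgmFatMultiplier L M klE0 β (nambuXiCT L μ K) (d * k - 1))) X'' X'‖ ≤ crb)
    (hcol' : ∀ X', ∑ X'', ‖(sectorAnalysisMatrix L M β (klAnisoFamily L M β μ K klE0 (d * k)) *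
        sectorSubMatrix L M β (bgmFatMultiplier L M klE0 β (nambuXiCT L μ K) (d * k - 1))) X'' X'‖ ≤ ccb)
    {D : ℕ} (hD : Fintype.card (SpaceTimeIdx L M × SectorLeg (sectorCount (d * k - 1))) / 2 ≤ D)
    {N : ℕ} (hN : 1 ≤ N)
    (hguard : 9 * αb * ccb / ((27 : ℝ) ^ 5 * exp 1 * κb ^ 2 * crb) *
      towerV D (exp 2 * κb ^ 2 / ccb ^ 2)
        (fun m => 64 * (27 : ℝ) ^ 4 * exp 2 * crb / ccb * (exp 4 * ccb ^ 2 * imagTimeWeight β M ^ 2 / 8) ^ m * klTowerMuLevF L M β U μ K d k m) < 1)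
    (t : Fin 5) (q : ℕ) :
    klTowerBLevF L M β U μ K d t (k + 1) (q + 1) ≤
      towerFO D (κb ^ 2 / (exp 4 * ccb ^ 2))
          (fun m => 64 * (27 : ℝ) ^ 4 * exp 2 * crb / ccb * (exp 4 * ccb ^ 2 * imagTimeWeight β M ^ 2 / 8) ^ m * klTowerMuLevF L M β U μ K d k m) (q + 1) +
        ∑ n ∈ Icc 2 N, exp 1 * (9 * αb * ccb / ((27 : ℝ) ^ 5 * exp 1 * κb ^ 2 * crb)) ^ (n - 1) * (exp 4 * ccb ^ 2 / κb ^ 2) ^ (q + 1) *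
          towerS D (exp 2 * κb ^ 2 / ccb ^ 2)
            (fun m => 64 * (27 : ℝ) ^ 4 * exp 2 * crb / ccb * (exp 4 * ccb ^ 2 * imagTimeWeight β M ^ 2 / 8) ^ m * klTowerMuLevF L M β U μ K d k m) n (q + 1) +
        (exp 4 * ccb ^ 2 / κb ^ 2) ^ (q + 1) * exp 1 *
          towerV D (exp 2 * κb ^ 2 / ccb ^ 2)
            (fun m => 64 * (27 : ℝ) ^ 4 * exp 2 * crb / ccb * (exp 4 * ccb ^ 2 * imagTimeWeight β M ^ 2 / 8) ^ m * klTowerMuLevF L M β U μ K d k m) *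
          (9 * αb * ccb / ((27 : ℝ) ^ 5 * exp 1 * κb ^ 2 * crb) *
            towerV D (exp 2 * κb ^ 2 / ccb ^ 2)
              (fun m => 64 * (27 : ℝ) ^ 4 * exp 2 * crb / ccb * (exp 4 * ccb ^ 2 * imagTimeWeight β M ^ 2 / 8) ^ m * klTowerMuLevF L M β U μ K d k m)) ^ N /
          (1 - 9 * αb * ccb / ((27 : ℝ) ^ 5 * exp 1 * κb ^ 2 * crb) *
            towerV D (exp 2 * κb ^ 2 / ccb ^ 2)
              (fun m => 64 * (27 : ℝ) ^ 4 * exp 2 * crb / ccb * (exp 4 * ccb ^ 2 * imagTimeWeight β M ^ 2 / 8) ^ m * klTowerMuLevF L M β U μ K d k m)) := by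
  have hx : 0 < imagTimeWeight β M := imagTimeWeight_pos_of_pos (M := M) hβ
  have hJ₁ : 1 ≤ d * k := by omega
  have h8 : (0 : ℝ) < (8 : ℝ) ^ (d * k) := by positivity
  have he1 : 0 < exp 1 := exp_pos 1
  have he2 : 0 < exp 2 := exp_pos 2
  have he4 : 0 < exp 4 := exp_pos 4
  have he4' : exp 4 = exp 2 ^ 2 := by rw [← Real.exp_nat_mul]; norm_num
  have he6' : exp 6 = exp 2 * exp 4 := by rw [← exp_add]; norm_num
  have he2' : exp 2 = exp 1 ^ 2 := by rw [← Real.exp_nat_mul]; norm_num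
  -- the Gram constant at the bound: `κ′ ≥ κ`, `κ′²·8^{dk} = κ̄²`
  obtain ⟨κ', hκ'0, hκκ', hκ'sq⟩ := exists_sqrt_scaled hκ hκb h8 hκκb
  have hGB' := TorusFourierL2.isGramBoundedR_of_le hGB hκ.le hκκ'
  -- the decay constant at the bound
  have hα'0 : 0 < αb * (4 : ℝ) ^ (d * k) := by positivity
  have hrow2 : ∀ X, ∑ Y, ‖((sectorSubMatrix L M β (bgmFatMultiplier L M klE0 β (nambuXiCT L μ K) (d * k - 1))).transpose *
      hubbardCovSliceCT L M β μ 0 K (klScale klE0 (d * (k + 1))) (klScale klE0 (d * k)) *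
        sectorSubMatrix L M β (bgmFatMultiplier L M klE0 β (nambuXiCT L μ K) (d * k - 1))) X Y‖ ≤ αb * (4 : ℝ) ^ (d * k) :=
    fun X => (hrow X).trans hααb
  have hcol2 : ∀ Y, ∑ X, ‖((sectorSubMatrix L M β (bgmFatMultiplier L M klE0 β (nambuXiCT L μ K) (d * k - 1))).transpose *
      hubbardCovSliceCT L M β μ 0 K (klScale klE0 (d * (k + 1))) (klScale klE0 (d * k)) *
        sectorSubMatrix L M β (bgmFatMultiplier L M klE0 β (nambuXiCT L μ K) (d * k - 1))) X Y‖ ≤ αb * (4 : ℝ) ^ (d * k) :=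
    fun Y => (hcol Y).trans hααb
  -- kit parameters `τ := e⁶κ′²`, `ψ := κ′⁻²`, `ρ := κ′`
  have he6 : exp 3 ^ 2 = exp 6 := by rw [← Real.exp_nat_mul]; norm_num
  have hτ1 : (exp 3 * κ') ^ 2 ≤ exp 6 * κ' ^ 2 := by rw [mul_pow, he6]
  have hτ2 : (exp 2 * (κ' + κ')) ^ 2 ≤ exp 6 * κ' ^ 2 := by
    have hk2 : 0 ≤ κ' ^ 2 := sq_nonneg _
    calc (exp 2 * (κ' + κ')) ^ 2 = 4 * exp 4 * κ' ^ 2 := by rw [he4']; ring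
      _ ≤ exp 2 * exp 4 * κ' ^ 2 := mul_le_mul_of_nonneg_right (mul_le_mul_of_nonneg_right four_le_exp_two he4.le) hk2
      _ = exp 6 * κ' ^ 2 := by rw [he6']
  have hψ1 : κ'⁻¹ ^ 2 ≤ κ'⁻¹ ^ 2 := le_rfl
  -- abbreviations: units, arrays, parameters
  set ε : ℝ := imagTimeWeight β M with hε
  set Kc : ℝ := ε * ((((2 : ℝ) ^ (5 * (d * k))))⁻¹ * (ε ^ 2)⁻¹) with hKc
  set u : ℝ := (8 : ℝ) ^ (d * k) * ε ^ 2 with hu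
  set μd : ℕ → ℝ := fun m => 32 * ε / 27 * (1 / 8 : ℝ) ^ m * klTowerMuLevF L M β U μ K d k m with hμd
  set θg : ℝ := ((1 / 2 : ℝ) ^ (d * k - 1)) ^ lumps ((t : ℕ) + 1) with hθg
  set Φ : ℝ := exp 1 * (9 * (αb * (4 : ℝ) ^ (d * k))) / κ' ^ 2 with hΦ
  set W : ℝ := 64 * (27 : ℝ) ^ 4 * exp 2 * crb / ccb with hW
  set Z : ℝ := exp 4 * ccb ^ 2 * ε ^ 2 / 8 with hZ'
  set σb : ℝ := κb ^ 2 / (exp 4 * ccb ^ 2) with hσb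
  set τb : ℝ := exp 2 * κb ^ 2 / ccb ^ 2 with hτb
  set ψb : ℝ := exp 4 * ccb ^ 2 / κb ^ 2 with hψb
  set Φb : ℝ := 9 * αb * ccb / ((27 : ℝ) ^ 5 * exp 1 * κb ^ 2 * crb) with hΦb
  set C : ℝ := 4 * (27 : ℝ) ^ 5 * (exp 4 / 2 * crb) with hC
  set K₂ : ℝ := (ε * exp 2 * ccb)⁻¹ with hK₂
  set u₂ : ℝ := ε ^ 2 * exp 4 * ccb ^ 2 with hu₂
  have hKc0 : 0 < Kc := by positivity
  have hu0 : 0 < u := by positivity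
  have hμd0 : ∀ m, 0 ≤ μd m := fun m => by
    have := klTowerMuLevF_nonneg (L := L) (M := M) hβ U μ K d k m
    simp only [hμd]; positivity
  have hθg0 : 0 ≤ θg := by positivity
  have hΦ0 : 0 ≤ Φ := by positivity
  have hC0 : 0 < C := by positivity
  have hK₂0 : 0 < K₂ := by positivity
  have hu₂0 : 0 < u₂ := by positivity
  -- the graded floor array in product units (as a function)
  have hBmNc : (fun m : ℕ => imagTimeWeight β M * klTowerMuLevF L M β U μ K d k m * klLevUnitF β M 0 m (d * k - 1) / 27) =
      fun m : ℕ => Kc * (u ^ m * μd m) := towerBmF_eq_units hβ U μ K hJ₁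
  have hNc0 : ∀ m, 0 ≤ (fun m : ℕ => Kc * (u ^ m * μd m)) m := fun m => by have := hμd0 m; positivity
  have hNc00 : (fun m : ℕ => Kc * (u ^ m * μd m)) 0 = 0 := by
    simp only [hμd, klTowerMuLevF_degree_zero, mul_zero]
  have hNtB : ∀ m, imagTimeWeight β M * klTowerMeasLev L M β U μ K d k (2 * m) 0 ≤ (fun m : ℕ => Kc * (u ^ m * μd m)) m := fun m => by
    rw [← hBmNc]; exact imagTimeWeight_mul_klTowerMeasLev_zero_le_towerBmF hβ U μ K d k hZ m
  have hNF : ∀ m c, (t : ℕ) + 1 ≤ c + 1 → c ≤ (t : ℕ) + 1 →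
      (27 : ℝ) ^ c * (imagTimeWeight β M *
        (if c = 0 then klTowerMeasLev L M β U μ K d k (2 * m) 0 else klTowerMeasLev L M β U μ K d k (2 * m) (c + 1))) ≤
      (fun m : ℕ => (27 : ℝ) ^ ((t : ℕ) + 1) * θg * (Kc * (u ^ m * μd m))) m := fun m c h1 h2 => by
    have h := towerNF_row_le (L := L) (M := M) hβ U μ K d k hZ ((t : ℕ) + 1) m c h1 h2
    rw [hBmNc] at h
    simpa only [hθg, mul_assoc] using h
  -- the final array in product units (as a function)
  have hμbar : (fun m : ℕ => W * Z ^ m * klTowerMuLevF L M β U μ K d k m) = fun m : ℕ => (C * K₂) * (u₂ ^ m * μd m) := by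
    funext m
    simp only [hW, hZ', hC, hK₂, hu₂, hμd]
    rw [he4']
    field_simp
    ring
  -- guard bookkeeping: `towerV` of the two arrays
  have hVNc : towerV D (exp 6 * κ' ^ 2) (fun m : ℕ => Kc * (u ^ m * μd m)) = Kc * towerV D (exp 6 * κ' ^ 2 * u) μd := towerV_units D _ Kc u μd
  have hVbar : towerV D τb (fun m : ℕ => W * Z ^ m * klTowerMuLevF L M β U μ K d k m) = (C * K₂) * towerV D (τb * u₂) μd := by
    rw [hμbar]; exact towerV_units D _ (C * K₂) u₂ μd
  -- the four parameter identities and the output constant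
  have hσeq : σb * u₂ = κ' ^ 2 * u := by
    simp only [hσb, hu₂, hu]; rw [← hκ'sq]; field_simp
  have hτeq : τb * u₂ = exp 6 * κ' ^ 2 * u := by
    simp only [hτb, hu₂, hu]; rw [← hκ'sq, he6']; field_simp
  have hψeq : ψb / u₂ = κ'⁻¹ ^ 2 / u := by
    simp only [hψb, hu₂, hu]; rw [← hκ'sq, inv_pow]; field_simp
  have h32 : (2 : ℝ) ^ (5 * (d * k)) = (4 : ℝ) ^ (d * k) * (8 : ℝ) ^ (d * k) := by
    rw [← mul_pow, show (4 : ℝ) * 8 = 2 ^ 5 by norm_num, ← pow_mul]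
  have hΦeq : Φb * (C * K₂) = 2 * Φ * Kc := by
    simp only [hΦb, hC, hK₂, hΦ, hKc]
    rw [h32, ← hκ'sq, he4', he2']
    field_simp
    ring
  have hout : ε ^ (2 * q + 1) * ((4 * (27 : ℝ) ^ 5) * ((exp 4 / 2 * crb) * (exp 2 * ccb) ^ (2 * q + 1))) = u₂ ^ (q + 1) * (C * K₂) := by
    simp only [hu₂, hC, hK₂]
    rw [he4']
    field_simp
    ring
  -- the guards of the kit form and of the re-truncation, from the final guard
  have hguard2 : 2 * Φ * towerV D (exp 6 * κ' ^ 2) (fun m : ℕ => Kc * (u ^ m * μd m)) < 1 := by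
    have key : 2 * Φ * towerV D (exp 6 * κ' ^ 2) (fun m : ℕ => Kc * (u ^ m * μd m)) =
        Φb * towerV D τb (fun m : ℕ => W * Z ^ m * klTowerMuLevF L M β U μ K d k m) := by
      rw [hVNc, hVbar, hτeq]
      calc 2 * Φ * (Kc * towerV D (exp 6 * κ' ^ 2 * u) μd) = (2 * Φ * Kc) * towerV D (exp 6 * κ' ^ 2 * u) μd := by ring
        _ = (Φb * (C * K₂)) * towerV D (exp 6 * κ' ^ 2 * u) μd := by rw [hΦeq]
        _ = Φb * ((C * K₂) * towerV D (exp 6 * κ' ^ 2 * u) μd) := by ring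
    rw [key]; exact hguard
  have hguardkit : exp 1 * (9 * (αb * (4 : ℝ) ^ (d * k))) / κ' ^ 2 * towerV D (exp 6 * κ' ^ 2) (fun m : ℕ => Kc * (u ^ m * μd m)) < 1 := by
    have hV0 : 0 ≤ towerV D (exp 6 * κ' ^ 2) (fun m : ℕ => Kc * (u ^ m * μd m)) := towerV_nonneg (by positivity) hNc0
    have : Φ * towerV D (exp 6 * κ' ^ 2) (fun m : ℕ => Kc * (u ^ m * μd m)) ≤
        2 * Φ * towerV D (exp 6 * κ' ^ 2) (fun m : ℕ => Kc * (u ^ m * μd m)) := by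
      rw [mul_assoc]; exact le_mul_of_one_le_left (mul_nonneg hΦ0 hV0) one_le_two
    exact lt_of_le_of_lt this hguard2
  -- (1) k3c3-p2's per-level born bound at truncation `N + 2(dk−1) + 1`, tail majorant `Nt := Bm`, first-order majorant `NF := 27^F·θ^g·Bm`
  have hN₀ : 2 ≤ N + 2 * (d * k - 1) + 1 := by omega
  have h1 := klTowerBornLev_le_kit_orientedF9 (L := L) (M := M) hβ U μ K hd hk hdk hZ hκ'0 hGB' hα'0 hrow2 hcol2 hκ'0 hcrb.le hccb.le hrow' hcol'
    hN₀ q ((t : ℕ) + 1) hNc0 hNc00 hNtB hNF hD hτ1 hτ2 hψ1 hψ1 hguardkit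
  rw [hBmNc] at h1
  -- (2) the pieces of the bracket
  set V : ℝ := towerV D (exp 6 * κ' ^ 2) (fun m : ℕ => Kc * (u ^ m * μd m)) with hVdef
  set S : ℝ := ∑ n ∈ Icc 2 (N + 2 * (d * k - 1) + 1 - 1), exp 1 * Φ ^ (n - 1) * (κ'⁻¹ ^ 2) ^ (q + 1) *
    towerS D (exp 6 * κ' ^ 2) (fun m : ℕ => Kc * (u ^ m * μd m)) n (q + 1) with hS
  set T : ℝ := (κ'⁻¹ ^ 2) ^ (q + 1) * (exp 1 * V * (Φ * V) ^ (N + 2 * (d * k - 1) + 1 - 1) / (1 - Φ * V)) with hT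
  set S' : ℝ := ∑ n ∈ Icc 2 N, exp 1 * (2 * Φ) ^ (n - 1) * (κ'⁻¹ ^ 2) ^ (q + 1) *
    towerS D (exp 6 * κ' ^ 2) (fun m : ℕ => Kc * (u ^ m * μd m)) n (q + 1) with hS'
  set T' : ℝ := (κ'⁻¹ ^ 2) ^ (q + 1) * (exp 1 * V * (2 * Φ * V) ^ N / (1 - 2 * Φ * V)) with hT'
  set FO' : ℝ := towerFO D (κ' ^ 2) (fun m : ℕ => Kc * (u ^ m * μd m)) (q + 1) with hFO'
  have hV0 : 0 ≤ V := towerV_nonneg (by positivity) hNc0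
  have hΦV : 2 * Φ * V < 1 := hguard2
  have hS'0 : 0 ≤ S' := sum_nonneg fun n _ => by
    have := towerS_nonneg (D := D) (τ := exp 6 * κ' ^ 2) (by positivity) hNc0 n (q + 1); positivity
  have hT'0 : 0 ≤ T' := by
    have h2ΦV : 0 ≤ 2 * Φ * V := by positivity
    exact mul_nonneg (by positivity) (div_nonneg (by positivity) (sub_nonneg.2 hΦV.le))
  have hFO'0 : 0 ≤ FO' := towerFO_nonneg (by positivity) hNc0 _
  -- the first-order majorant's `towerFO` is `27^F·θ^g` times `FO′`
  have hFO : towerFO D (κ' ^ 2) (fun m : ℕ => (27 : ℝ) ^ ((t : ℕ) + 1) * θg * (Kc * (u ^ m * μd m))) (q + 1) = (27 : ℝ) ^ ((t : ℕ) + 1) * θg * FO' :=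
    towerFO_mul_left _ _ _ _
  -- (3) re-truncation: the tail earns `θ^g`
  have hre : θg * S + T ≤ θg * (S' + T') :=
    orientedBracket_retruncate_le_kitStep (D := D) (p := q + 1) (N := N) (K := 2 * (d * k - 1)) (τ := exp 6 * κ' ^ 2) (ψ := κ'⁻¹ ^ 2)
      (Φ := Φ) (w := θg) (μ := fun m : ℕ => Kc * (u ^ m * μd m)) (by positivity) (by positivity) hΦ0 hNc0 hθg0
      (half_pow_le_towerTheta_pow_lumps d k ((t : ℕ) + 1)) hN hguard2
  -- (4) the literal bracket
  have hlit := kitBrackets_explicitFO_le_literal (FO := FO') (S := S') (T := T') hcrb.le hccb.le hFO'0 hS'0 hT'0 q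
  -- (5) the born bound, assembled
  have h27F : (0 : ℝ) ≤ (27 : ℝ) ^ ((t : ℕ) + 1) := by positivity
  have hA0 : 0 ≤ crb * ccb ^ (2 * q + 1) := by positivity
  have hborn : klTowerBornLev L M β U μ K d k (2 * (q + 1)) ((t : ℕ) + 1) ≤
      ε ^ (2 * q + 1) * ((27 : ℝ) ^ ((t : ℕ) + 1) * θg) * ((exp 4 / 2 * crb) * (exp 2 * ccb) ^ (2 * q + 1) * (FO' + S' + T')) := by
    rw [hFO] at h1
    calc klTowerBornLev L M β U μ K d k (2 * (q + 1)) ((t : ℕ) + 1)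
        ≤ ε ^ (2 * q + 1) * (crb * ccb ^ (2 * q + 1) * ((27 : ℝ) ^ ((t : ℕ) + 1) * (θg * S + T)) +
            crb * ccb ^ (2 * q + 1) * (exp 2 ^ (q + 2) / 2 * ((27 : ℝ) ^ ((t : ℕ) + 1) * θg * FO'))) := h1
      _ ≤ ε ^ (2 * q + 1) * (crb * ccb ^ (2 * q + 1) * ((27 : ℝ) ^ ((t : ℕ) + 1) * (θg * (S' + T'))) +
            crb * ccb ^ (2 * q + 1) * (exp 2 ^ (q + 2) / 2 * ((27 : ℝ) ^ ((t : ℕ) + 1) * θg * FO'))) := by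
          gcongr
      _ = ε ^ (2 * q + 1) * ((27 : ℝ) ^ ((t : ℕ) + 1) * θg) *
            (crb * ccb ^ (2 * q + 1) * (S' + T') + crb * ccb ^ (2 * q + 1) * (exp 2 ^ (q + 2) / 2 * FO')) := by ring
      _ ≤ ε ^ (2 * q + 1) * ((27 : ℝ) ^ ((t : ℕ) + 1) * θg) * ((exp 4 / 2 * crb) * (exp 2 * ccb) ^ (2 * q + 1) * (FO' + S' + T')) :=
          mul_le_mul_of_nonneg_left hlit (by positivity)
  -- (6) the kit bracket in the input units: `FO′ + S′ + T′ = (u^p·Kc)·kit₁`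
  have hkit := kitStep_abs_eq_units_mul (K := Kc) (u := u) hKc0.ne' hu0.ne' D (κ' ^ 2) (exp 6 * κ' ^ 2) (2 * Φ) (κ'⁻¹ ^ 2) μd N (q + 1)
  have hFST : FO' + S' + T' = towerFO D (κ' ^ 2) (fun m : ℕ => Kc * (u ^ m * μd m)) (q + 1) +
      ∑ n ∈ Icc 2 N, exp 1 * (2 * Φ) ^ (n - 1) * (κ'⁻¹ ^ 2) ^ (q + 1) * towerS D (exp 6 * κ' ^ 2) (fun m : ℕ => Kc * (u ^ m * μd m)) n (q + 1) +
      (κ'⁻¹ ^ 2) ^ (q + 1) * exp 1 * towerV D (exp 6 * κ' ^ 2) (fun m : ℕ => Kc * (u ^ m * μd m)) *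
        (2 * Φ * towerV D (exp 6 * κ' ^ 2) (fun m : ℕ => Kc * (u ^ m * μd m))) ^ N /
        (1 - 2 * Φ * towerV D (exp 6 * κ' ^ 2) (fun m : ℕ => Kc * (u ^ m * μd m))) := by
    simp only [hFO', hS', hT', hVdef]; ring
  set kit₁ : ℝ := towerFO D (κ' ^ 2 * u) μd (q + 1) +
      ∑ n ∈ Icc 2 N, exp 1 * (2 * Φ * Kc) ^ (n - 1) * (κ'⁻¹ ^ 2 / u) ^ (q + 1) * towerS D (exp 6 * κ' ^ 2 * u) μd n (q + 1) +
      (κ'⁻¹ ^ 2 / u) ^ (q + 1) * exp 1 * towerV D (exp 6 * κ' ^ 2 * u) μd * (2 * Φ * Kc * towerV D (exp 6 * κ' ^ 2 * u) μd) ^ N /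
        (1 - 2 * Φ * Kc * towerV D (exp 6 * κ' ^ 2 * u) μd) with hkit₁
  have hFST' : FO' + S' + T' = (u ^ (q + 1) * Kc) * kit₁ := by rw [hFST, hkit]
  have hkit₁0 : 0 ≤ kit₁ := by
    have h0 : 0 ≤ FO' + S' + T' := by positivity
    rw [hFST'] at h0
    by_contra hneg
    exact absurd h0 (not_le.mpr (mul_neg_of_pos_of_neg (by positivity : 0 < u ^ (q + 1) * Kc) (lt_of_not_ge hneg)))
  -- (7) divide by the output unit
  have hunit : klLevUnitF β M t (q + 1) (d * k) = ((2 : ℝ) ^ (klLevGain t * (d * k)))⁻¹ * (Kc * u ^ (q + 1)) :=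
    klLevUnitF_eq_pow_inv_mul_units (M := M) hβ t (by omega) (d * k)
  have hU0 : 0 < klLevUnitF β M t (q + 1) (d * k) := klLevUnitF_pos hβ t _ _
  have hθ2 : θg * (2 : ℝ) ^ (klLevGain t * (d * k)) = (2 : ℝ) ^ klLevGain t := by
    rw [hθg, ← klLevGain_eq_lumps]; exact towerTheta_pow_mul_two_pow hJ₁ _
  have h274 : (27 : ℝ) ^ ((t : ℕ) + 1) * (2 : ℝ) ^ klLevGain t ≤ 4 * (27 : ℝ) ^ 5 := pow27_mul_two_pow_klLevGain_le t
  have hBLev : klTowerBLevF L M β U μ K d t (k + 1) (q + 1) ≤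
      ε ^ (2 * q + 1) * (4 * (27 : ℝ) ^ 5) * ((exp 4 / 2 * crb) * (exp 2 * ccb) ^ (2 * q + 1)) * kit₁ := by
    rw [klTowerBLevF_succ, div_le_iff₀ hU0]
    refine hborn.trans ?_
    rw [hFST', hunit]
    have hX : 0 ≤ ε ^ (2 * q + 1) * ((exp 4 / 2 * crb) * (exp 2 * ccb) ^ (2 * q + 1)) * kit₁ * (Kc * u ^ (q + 1)) := by positivity
    calc ε ^ (2 * q + 1) * ((27 : ℝ) ^ ((t : ℕ) + 1) * θg) * ((exp 4 / 2 * crb) * (exp 2 * ccb) ^ (2 * q + 1) * ((u ^ (q + 1) * Kc) * kit₁))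
        = ((27 : ℝ) ^ ((t : ℕ) + 1) * (θg * (2 : ℝ) ^ (klLevGain t * (d * k)))) *
            (ε ^ (2 * q + 1) * ((exp 4 / 2 * crb) * (exp 2 * ccb) ^ (2 * q + 1)) * kit₁ * (Kc * u ^ (q + 1))) *
            ((2 : ℝ) ^ (klLevGain t * (d * k)))⁻¹ := by
          field_simp
      _ ≤ (4 * (27 : ℝ) ^ 5) * (ε ^ (2 * q + 1) * ((exp 4 / 2 * crb) * (exp 2 * ccb) ^ (2 * q + 1)) * kit₁ * (Kc * u ^ (q + 1))) *
            ((2 : ℝ) ^ (klLevGain t * (d * k)))⁻¹ := by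
          rw [hθ2]
          exact mul_le_mul_of_nonneg_right (mul_le_mul_of_nonneg_right h274 hX) (by positivity)
      _ = ε ^ (2 * q + 1) * (4 * (27 : ℝ) ^ 5) * ((exp 4 / 2 * crb) * (exp 2 * ccb) ^ (2 * q + 1)) * kit₁ *
            (((2 : ℝ) ^ (klLevGain t * (d * k)))⁻¹ * (Kc * u ^ (q + 1))) := by ring
  -- (8) the output constant into the array: the final kit shape
  have hkit2 := kitStep_abs_eq_units_mul (K := C * K₂) (u := u₂) (mul_pos hC0 hK₂0).ne' hu₂0.ne' D σb τb Φb ψb μd N (q + 1)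
  have hfin : towerFO D σb (fun m : ℕ => W * Z ^ m * klTowerMuLevF L M β U μ K d k m) (q + 1) +
      ∑ n ∈ Icc 2 N, exp 1 * Φb ^ (n - 1) * ψb ^ (q + 1) * towerS D τb (fun m : ℕ => W * Z ^ m * klTowerMuLevF L M β U μ K d k m) n (q + 1) +
      ψb ^ (q + 1) * exp 1 * towerV D τb (fun m : ℕ => W * Z ^ m * klTowerMuLevF L M β U μ K d k m) *
        (Φb * towerV D τb (fun m : ℕ => W * Z ^ m * klTowerMuLevF L M β U μ K d k m)) ^ N /
        (1 - Φb * towerV D τb (fun m : ℕ => W * Z ^ m * klTowerMuLevF L M β U μ K d k m)) =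
      ε ^ (2 * q + 1) * (4 * (27 : ℝ) ^ 5) * ((exp 4 / 2 * crb) * (exp 2 * ccb) ^ (2 * q + 1)) * kit₁ := by
    rw [hμbar, hkit2, hσeq, hτeq, hψeq, hΦeq, ← hkit₁]
    rw [show ε ^ (2 * q + 1) * (4 * (27 : ℝ) ^ 5) * ((exp 4 / 2 * crb) * (exp 2 * ccb) ^ (2 * q + 1)) =
      u₂ ^ (q + 1) * (C * K₂) by rw [← hout]; ring]
  rw [hfin]
  exact hBLev

/-! ## §2 The `hstep` binder of the floor-keyed levelled law, uniformly in the block -/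

/-- **THE k-UNIFORM FLOOR LINK** («(ℓ)-LINK-UNIFORM-F»): the `hstep` binder of `klTowerBLevF_le_law_lev_of_doors_of_wgridStep` (…TowerLevBaseFWgrid) VERBATIM —
blocks `1 ≤ k < Kb`, the law's six names `W Z σ τ ψ Φ` pinned by equations (instantiate each with `rfl`) to `W = 64·27⁴·e²·c̄r/c̄c`, `Z = e⁴c̄c²ε²/8`,
`σ = κ̄²/(e⁴c̄c²)`, `τ = e²κ̄²/c̄c²`, `ψ = e⁴c̄c²/κ̄²`, `Φ = 9ᾱc̄c/(27⁵·e·κ̄²·c̄r)` — from the per-block partition-function, Gram, decay and overlap data under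
the four k-free bounds `κ_k²·8^{dk} ≤ κ̄²`, `α_k ≤ ᾱ·4^{dk}`, analysis-overlap sums `≤ c̄r, c̄c`, and `card/2 ≤ D` (`2 ≤ d`).
[cite: BenfattoGiulianiMastropietro2006, §2.8 (2.76)-(2.84), (2.97)-(2.98), §3 (3.2)-(3.8)] -/
theorem levLawF_hstep_of_blockBounds {β : ℝ} (hβ : 0 < β) (U μ : ℝ) (K : TrigPolyC4v) {d : ℕ} (hd : 2 ≤ d) (Kb : ℕ)
    (hZ : ∀ k, 1 ≤ k → k < Kb → hubbardEffPartitionFnCT L M β U μ 0 K (klScale klE0 (d * k)) ≠ 0)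
    {κb αb crb ccb : ℝ} (hκb : 0 < κb) (hαb : 0 < αb) (hcrb : 0 < crb) (hccb : 0 < ccb)
    (κ α : ℕ → ℝ) (hκ : ∀ k, 1 ≤ k → k < Kb → 0 < κ k) (hκκb : ∀ k, 1 ≤ k → k < Kb → κ k ^ 2 * (8 : ℝ) ^ (d * k) ≤ κb ^ 2)
    (hααb : ∀ k, 1 ≤ k → k < Kb → α k ≤ αb * (4 : ℝ) ^ (d * k))
    (hGB : ∀ k, 1 ≤ k → k < Kb → IsGramBoundedR ((sectorSubMatrix L M β (bgmFatMultiplier L M klE0 β (nambuXiCT L μ K) (d * k - 1))).transpose *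
      hubbardCovSliceCT L M β μ 0 K (klScale klE0 (d * (k + 1))) (klScale klE0 (d * k)) *
        sectorSubMatrix L M β (bgmFatMultiplier L M klE0 β (nambuXiCT L μ K) (d * k - 1))) (κ k))
    (hrow : ∀ k, 1 ≤ k → k < Kb → ∀ X, ∑ Y, ‖((sectorSubMatrix L M β (bgmFatMultiplier L M klE0 β (nambuXiCT L μ K) (d * k - 1))).transpose *
        hubbardCovSliceCT L M β μ 0 K (klScale klE0 (d * (k + 1))) (klScale klE0 (d * k)) *
          sectorSubMatrix L M β (bgmFatMultiplier L M klE0 β (nambuXiCT L μ K) (d * k - 1))) X Y‖ ≤ α k)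
    (hcol : ∀ k, 1 ≤ k → k < Kb → ∀ Y, ∑ X, ‖((sectorSubMatrix L M β (bgmFatMultiplier L M klE0 β (nambuXiCT L μ K) (d * k - 1))).transpose *
        hubbardCovSliceCT L M β μ 0 K (klScale klE0 (d * (k + 1))) (klScale klE0 (d * k)) *
          sectorSubMatrix L M β (bgmFatMultiplier L M klE0 β (nambuXiCT L μ K) (d * k - 1))) X Y‖ ≤ α k)
    (hrow' : ∀ k, 1 ≤ k → k < Kb → ∀ X'', ∑ X', ‖(sectorAnalysisMatrix L M β (klAnisoFamily L M β μ K klE0 (d * k)) *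
        sectorSubMatrix L M β (bgmFatMultiplier L M klE0 β (nambuXiCT L μ K) (d * k - 1))) X'' X'‖ ≤ crb)
    (hcol' : ∀ k, 1 ≤ k → k < Kb → ∀ X', ∑ X'', ‖(sectorAnalysisMatrix L M β (klAnisoFamily L M β μ K klE0 (d * k)) *
        sectorSubMatrix L M β (bgmFatMultiplier L M klE0 β (nambuXiCT L μ K) (d * k - 1))) X'' X'‖ ≤ ccb)
    {D : ℕ} (hD : ∀ k, 1 ≤ k → k < Kb → Fintype.card (SpaceTimeIdx L M × SectorLeg (sectorCount (d * k - 1))) / 2 ≤ D)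
    {W Z σ τ ψ Φ : ℝ}
    (hW : W = 64 * (27 : ℝ) ^ 4 * exp 2 * crb / ccb) (hZ' : Z = exp 4 * ccb ^ 2 * imagTimeWeight β M ^ 2 / 8)
    (hσ : σ = κb ^ 2 / (exp 4 * ccb ^ 2)) (hτ : τ = exp 2 * κb ^ 2 / ccb ^ 2) (hψ : ψ = exp 4 * ccb ^ 2 / κb ^ 2)
    (hΦ : Φ = 9 * αb * ccb / ((27 : ℝ) ^ 5 * exp 1 * κb ^ 2 * crb)) :
    ∀ t : Fin 5, ∀ k, 1 ≤ k → k < Kb → ∀ N : ℕ, 2 ≤ N → ∀ p, 3 ≤ p → p ≤ D →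
      Φ * towerV D τ (fun m => W * Z ^ m * klTowerMuLevF L M β U μ K d k m) < 1 →
      klTowerBLevF L M β U μ K d t (k + 1) p ≤
        towerFO D σ (fun m => W * Z ^ m * klTowerMuLevF L M β U μ K d k m) p +
          ∑ n ∈ Icc 2 N, exp 1 * Φ ^ (n - 1) * ψ ^ p * towerS D τ (fun m => W * Z ^ m * klTowerMuLevF L M β U μ K d k m) n p +
          ψ ^ p * exp 1 * towerV D τ (fun m => W * Z ^ m * klTowerMuLevF L M β U μ K d k m) *
            (Φ * towerV D τ (fun m => W * Z ^ m * klTowerMuLevF L M β U μ K d k m)) ^ N /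
            (1 - Φ * towerV D τ (fun m => W * Z ^ m * klTowerMuLevF L M β U μ K d k m)) := by
  subst hW hZ' hσ hτ hψ hΦ
  intro t k hk1 hk N hN p hp hpD hguard
  obtain ⟨q, rfl⟩ : ∃ q, p = q + 1 := ⟨p - 1, by omega⟩
  have hN1 : 1 ≤ N := by omega
  have hd1 : 1 ≤ d := by omega
  have hdk : 2 ≤ d * k := le_trans hd (Nat.le_mul_of_pos_right d hk1)
  exact klTowerBLevF_succ_le_kitStep_of_bounds hβ U μ K hd1 hk1 hdk (hZ k hk1 hk) (hκ k hk1 hk) hκb (hκκb k hk1 hk) (hGB k hk1 hk) hαb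
    (hααb k hk1 hk) (hrow k hk1 hk) (hcol k hk1 hk) hcrb hccb (hrow' k hk1 hk) (hcol' k hk1 hk) (hD k hk1 hk) hN1 hguard t q

end Summit.HubbardSuperconductivity.HubbardSuperconductivity.Theorems.EngineV8

end
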